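import Mathlib
import Summits.ValiantsHypothesis.ValiantsHypothesis.Theorems.SymPencilEquivariantSdcNotQPProof
import Summits.ValiantsHypothesis.ValiantsHypothesis.Theorems.SymPencilSymmetrizePermPairsStubInduce
import HarnessLib

/-!
# ValiantsHypothesis / SymPencil — crux `SymmetrizePermPairs` (stmt-ValiantsHypothesis-17793):
# the ⊥-SANDWICH (crux-strategist calibration, cstrat-17793)

Where the crux sits after p605543 (`stub_induce` a THEOREM) and the closure of item 17792
(`EquivariantSdcNotQP` PROVED):

* LOWER END.  Take `Γ' = ⊥` in the landed `stub_induce`: the relative index of `⊥` in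
  `Γ_n ≅ 𝔖_n × 𝔖_n` is `|Γ_n| ≤ (n!)²` (`relIndex_bot_permPairSubst_le`), and `⊥`-equivariance is no
  condition (`isEquivariantDetRepr_bot_iff`).  Hence the SYMMETRY-FREE lower bound
  `H : ∃ e, ∀ n m A, A symmetric affine pencil of per_n of size m → (n!)² ≤ 2^{(log₂ m + e)^e}`
  (an almost-everywhere weakly-exponential bound `sdc(per_n) ≥ 2^{(log₂((n!)²))^{1/e}} - e`) gives the
  only remaining registered stub `stub_stabIndex` TRIVIALLY (`stabIndex_of_factorialSq_le`), hence the
  crux (`symmetrizePermPairs_of_factorialSq_le`).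
* UPPER END.  With 17792 proved and the split glue `sdcThesis_derived` proved, the crux alone gives
  the route's deciding crux `SdcThesis` (≡ "VNP ⊄ VQP in the symmetric affine model", itself ≥ the
  summit): `sdcThesis_of_symmetrizePermPairs`.

So `H ⇒ stub_stabIndex ⇒ SymmetrizePermPairs ⇒ SdcThesis`: the symmetrisation crux is sandwiched
between two symmetry-free super-quasi-polynomial lower bounds for `sdc(per)` (a.e. weakly-exponential
below it, i.o. super-quasi-polynomial above it).  This is the calibration the crux directory lacked
(cf. `Cruxes/SdcThesis/Calibration.lean`, which only records `SdcThesis → EquivariantSdcNotQP`).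

Honest framing: CALIBRATION ONLY.  `H`, `stub_stabIndex`, the crux `SymmetrizePermPairs`, `SdcThesis`
and `VP ≠ VNP` all remain OPEN; nothing here is progress on `VP ≠ VNP`.  No new definitions, no named
facts (`--supports stmt-ValiantsHypothesis-17793`).  The registered skeleton
`Cruxes/SdcThesis/Lines/birth_SymmetrizePermPairs.lean` is not touched; `symmetrizePermPairs_of_stabIndex`
re-proves its composition against the tree theorem `stub_induce` with the closure group spelled out.
-/

noncomputable section

-- `Summit.ValiantsHypothesis.ValiantsHypothesis.…` is the tree's mandated single-conjunct layout
-- (Sub = Summit), so the duplicated namespace component is intended.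
set_option linter.dupNamespace false

namespace Summit.ValiantsHypothesis.ValiantsHypothesis.Theorems.SymPencilSymmetrizePermPairs.Sandwich

open Literature.Computability.AlgebraicComplexity MvPolynomial Matrix
open Summit.ValiantsHypothesis.ValiantsHypothesis.Theses
open Summit.ValiantsHypothesis.ValiantsHypothesis.Theorems.SymPencilSdcThesisSplit (qpExp_comp sdcThesis_derived)
open Summit.ValiantsHypothesis.ValiantsHypothesis.Theorems.SymPencilEquivariantSdcNotQP (permPairSubst_eq_range stub_induce)

/-! ### The index of `⊥` in `Γ_n` -/

/-- `[Γ_n : ⊥] = |Γ_n| ≤ (n!)²`: `Γ_n` is the range of a homomorphism from `𝔖_n × 𝔖_n`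
(`permPairSubst_eq_range`). [folklore] -/
theorem relIndex_bot_permPairSubst_le (n : ℕ) :
    (⊥ : Subgroup (GL (Fin n × Fin n) ℂ)).relIndex (Subgroup.closure {γ : GL (Fin n × Fin n) ℂ | ∃ π ρ : Equiv.Perm (Fin n), (γ : Matrix (Fin n × Fin n) (Fin n × Fin n) ℂ) = Equiv.Perm.permMatrix ℂ (Equiv.prodCongr π ρ)}) ≤ (Nat.factorial n) ^ 2 := by
  obtain ⟨θ, hθ⟩ := permPairSubst_eq_range n
  rw [Subgroup.relIndex_bot_left, hθ]
  calc Nat.card θ.range ≤ Nat.card (Equiv.Perm (Fin n) × Equiv.Perm (Fin n)) :=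
        Nat.card_le_card_of_surjective θ.rangeRestrict θ.rangeRestrict_surjective
    _ = (Nat.factorial n) ^ 2 := by
        rw [Nat.card_prod, Nat.card_perm, Nat.card_eq_fintype_card, Fintype.card_fin, sq]

/-! ### Lower end: the symmetry-free bound `(n!)² ≤ qp(m)` gives `stub_stabIndex` with `Γ' = ⊥` -/

/-- **`H ⇒ stub_stabIndex`.**  If every symmetric affine pencil of `per_n` of size `m` satisfies
`(n!)² ≤ 2^{(log₂ m + e)^e}`, then the registered stub `stub_stabIndex` (statement verbatim, the line
file's `abbrev permPairSubst n` spelled out) holds — with `Γ' = ⊥`, whose relative index is `≤ (n!)²`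
and for which equivariance is no condition.  The minimality hypothesis is not even used. [folklore] -/
theorem stabIndex_of_factorialSq_le
    (hH : ∃ e : ℕ, ∀ (n m : ℕ) (A : Matrix (Fin m) (Fin m) (MvPolynomial (Fin n × Fin n) ℂ)),
      A.IsSymm → IsAffineDetRepr (perPoly (Fin n) ℂ) A →
      (Nat.factorial n) ^ 2 ≤ 2 ^ ((Nat.log 2 m + e) ^ e)) :
    ∃ d : ℕ, ∀ (n m : ℕ) (A : Matrix (Fin m) (Fin m) (MvPolynomial (Fin n × Fin n) ℂ)),
      A.IsSymm → IsAffineDetRepr (perPoly (Fin n) ℂ) A →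
      (∀ (m' : ℕ) (A' : Matrix (Fin m') (Fin m') (MvPolynomial (Fin n × Fin n) ℂ)),
        A'.IsSymm → IsAffineDetRepr (perPoly (Fin n) ℂ) A' → m ≤ m') →
      ∃ Γ' : Subgroup (GL (Fin n × Fin n) ℂ), Γ' ≤ Subgroup.closure {γ : GL (Fin n × Fin n) ℂ | ∃ π ρ : Equiv.Perm (Fin n), (γ : Matrix (Fin n × Fin n) (Fin n × Fin n) ℂ) = Equiv.Perm.permMatrix ℂ (Equiv.prodCongr π ρ)} ∧
        Γ'.relIndex (Subgroup.closure {γ : GL (Fin n × Fin n) ℂ | ∃ π ρ : Equiv.Perm (Fin n), (γ : Matrix (Fin n × Fin n) (Fin n × Fin n) ℂ) = Equiv.Perm.permMatrix ℂ (Equiv.prodCongr π ρ)}) ≤ 2 ^ ((Nat.log 2 m + d) ^ d) ∧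
        IsEquivariantDetRepr Γ' (perPoly (Fin n) ℂ) A := by
  obtain ⟨e, he⟩ := hH
  refine ⟨e, fun n m A hAs hA _ => ⟨⊥, bot_le, ?_, isEquivariantDetRepr_bot_iff.mpr hA⟩⟩
  exact (relIndex_bot_permPairSubst_le n).trans (he n m A hAs hA)

/-! ### Arithmetic (quasi-polynomial budget bookkeeping) -/

/-- `L + 2 + (L + a)^a ≤ (L + 2 + (a+1))^{a+1}`. [folklore] -/
theorem aux_exp (L a : ℕ) : L + 2 + (L + a) ^ a ≤ (L + 2 + (a + 1)) ^ (a + 1) := by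
  rcases a with _ | a
  · simp
  · set b := L + 2 + (a + 1 + 1) with hb
    have hb3 : L + 3 ≤ b := by omega
    have hk : (L + (a + 1)) ^ (a + 1) ≤ b ^ (a + 1) := Nat.pow_le_pow_left (by omega) _
    have hbb : b ≤ b ^ (a + 1) := by
      calc b = b ^ 1 := (pow_one b).symm
        _ ≤ b ^ (a + 1) := Nat.pow_le_pow_right (by omega) (by omega)
    calc L + 2 + (L + (a + 1)) ^ (a + 1) ≤ b ^ (a + 1) + b ^ (a + 1) := by omega
      _ = 2 * b ^ (a + 1) := by ring
      _ ≤ b * b ^ (a + 1) := Nat.mul_le_mul_right _ (by omega)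
      _ = b ^ (a + 1 + 1) := by ring

/-- The budget of the composition "stabiliser index, then induce": if `m₀ ≤ m` and
`R ≤ 2^{(log₂ m₀ + a)^a}` then `2^{(log₂(m₀ R + m₀) + b)^b} ≤ 2^{(log₂ m + d)^d}` with
`d = (a+2)(b+1)+2`. [folklore] -/
theorem qpBudget (m m₀ R a b : ℕ) (hm₀m : m₀ ≤ m) (hidx : R ≤ 2 ^ ((Nat.log 2 m₀ + a) ^ a)) :
    2 ^ ((Nat.log 2 (m₀ * R + m₀) + b) ^ b) ≤
      2 ^ ((Nat.log 2 m + ((a + 2) * (b + 1) + 2)) ^ ((a + 2) * (b + 1) + 2)) := by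
  set L := Nat.log 2 m with hL
  have hQ : R ≤ 2 ^ ((L + a) ^ a) := by
    refine hidx.trans (Nat.pow_le_pow_right (by norm_num) ?_)
    exact Nat.pow_le_pow_left (by have := Nat.log_mono_right (b := 2) hm₀m; omega) a
  have hm2 : m < 2 ^ (L + 1) := Nat.lt_pow_succ_log_self one_lt_two m
  have hQ1 : 1 ≤ 2 ^ ((L + a) ^ a) := Nat.one_le_two_pow
  have hprod : m₀ * R + m₀ ≤ 2 ^ (L + 2 + (L + a) ^ a) := by
    have h1 : m₀ * R + m₀ ≤ m * 2 ^ ((L + a) ^ a) + m := by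
      have := Nat.mul_le_mul hm₀m hQ
      omega
    have h3 : m * 2 ^ ((L + a) ^ a) ≤ 2 ^ (L + 1) * 2 ^ ((L + a) ^ a) :=
      Nat.mul_le_mul_right _ hm2.le
    have h4 : m ≤ 2 ^ (L + 1) * 2 ^ ((L + a) ^ a) := by
      calc m ≤ 2 ^ (L + 1) := hm2.le
        _ = 2 ^ (L + 1) * 1 := (mul_one _).symm
        _ ≤ 2 ^ (L + 1) * 2 ^ ((L + a) ^ a) := Nat.mul_le_mul_left _ hQ1
    have h5 : 2 ^ (L + 1) * 2 ^ ((L + a) ^ a) + 2 ^ (L + 1) * 2 ^ ((L + a) ^ a) =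
        2 ^ (L + 2 + (L + a) ^ a) := by
      ring
    calc m₀ * R + m₀ ≤ m * 2 ^ ((L + a) ^ a) + m := h1
      _ ≤ 2 ^ (L + 1) * 2 ^ ((L + a) ^ a) + 2 ^ (L + 1) * 2 ^ ((L + a) ^ a) := by omega
      _ = 2 ^ (L + 2 + (L + a) ^ a) := h5
  have hlog : Nat.log 2 (m₀ * R + m₀) ≤ L + 2 + (L + a) ^ a := by
    calc Nat.log 2 (m₀ * R + m₀) ≤ Nat.log 2 (2 ^ (L + 2 + (L + a) ^ a)) := Nat.log_mono_right hprod
      _ = L + 2 + (L + a) ^ a := Nat.log_pow one_lt_two _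
  have hlog' : Nat.log 2 (m₀ * R + m₀) ≤ (L + 2 + (a + 1)) ^ (a + 1) := hlog.trans (aux_exp L a)
  apply Nat.pow_le_pow_right (by norm_num)
  calc (Nat.log 2 (m₀ * R + m₀) + b) ^ b
      ≤ ((L + 2 + (a + 1)) ^ (a + 1) + b) ^ b := Nat.pow_le_pow_left (by omega) b
    _ ≤ (L + 2 + (a + 2) * (b + 1)) ^ ((a + 2) * (b + 1)) := qpExp_comp (L + 2) (a + 1) b
    _ ≤ (L + ((a + 2) * (b + 1) + 2)) ^ ((a + 2) * (b + 1)) := Nat.pow_le_pow_left (by omega) _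
    _ ≤ (L + ((a + 2) * (b + 1) + 2)) ^ ((a + 2) * (b + 1) + 2) :=
        Nat.pow_le_pow_right (by omega) (by omega)

/-! ### `stub_stabIndex ⇒ SymmetrizePermPairs` against the landed `stub_induce` -/

/-- **`stub_stabIndex ⇒ SymmetrizePermPairs`** (the registered composition, re-proved against the
tree theorem `stub_induce`, p605543): pass to a minimal symmetric pencil (`Nat.find`), take its
quasi-polynomial-index symmetry subgroup (hypothesis), induce (`stub_induce`), compose the budgets
(`qpBudget`).  Concludes the crux BY NAME. [folklore] -/
theorem symmetrizePermPairs_of_stabIndex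
    (h₁ : ∃ d : ℕ, ∀ (n m : ℕ) (A : Matrix (Fin m) (Fin m) (MvPolynomial (Fin n × Fin n) ℂ)),
      A.IsSymm → IsAffineDetRepr (perPoly (Fin n) ℂ) A →
      (∀ (m' : ℕ) (A' : Matrix (Fin m') (Fin m') (MvPolynomial (Fin n × Fin n) ℂ)),
        A'.IsSymm → IsAffineDetRepr (perPoly (Fin n) ℂ) A' → m ≤ m') →
      ∃ Γ' : Subgroup (GL (Fin n × Fin n) ℂ), Γ' ≤ Subgroup.closure {γ : GL (Fin n × Fin n) ℂ | ∃ π ρ : Equiv.Perm (Fin n), (γ : Matrix (Fin n × Fin n) (Fin n × Fin n) ℂ) = Equiv.Perm.permMatrix ℂ (Equiv.prodCongr π ρ)} ∧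
        Γ'.relIndex (Subgroup.closure {γ : GL (Fin n × Fin n) ℂ | ∃ π ρ : Equiv.Perm (Fin n), (γ : Matrix (Fin n × Fin n) (Fin n × Fin n) ℂ) = Equiv.Perm.permMatrix ℂ (Equiv.prodCongr π ρ)}) ≤ 2 ^ ((Nat.log 2 m + d) ^ d) ∧
        IsEquivariantDetRepr Γ' (perPoly (Fin n) ℂ) A) :
    SymPencil.SymmetrizePermPairs := by
  obtain ⟨a, ha⟩ := h₁
  obtain ⟨b, hb⟩ := stub_induce
  unfold SymPencil.SymmetrizePermPairs
  refine ⟨(a + 2) * (b + 1) + 2, fun n m A hAs hA => ?_⟩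
  classical
  -- a minimal symmetric affine pencil of per_n
  have hex : ∃ k, ∃ B : Matrix (Fin k) (Fin k) (MvPolynomial (Fin n × Fin n) ℂ),
      B.IsSymm ∧ IsAffineDetRepr (perPoly (Fin n) ℂ) B := ⟨m, A, hAs, hA⟩
  obtain ⟨B, hBs, hB⟩ := Nat.find_spec hex
  have hmin : ∀ (m' : ℕ) (A' : Matrix (Fin m') (Fin m') (MvPolynomial (Fin n × Fin n) ℂ)),
      A'.IsSymm → IsAffineDetRepr (perPoly (Fin n) ℂ) A' → Nat.find hex ≤ m' :=
    fun m' A' h1 h2 => Nat.find_min' hex ⟨A', h1, h2⟩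
  have hm₀m : Nat.find hex ≤ m := hmin m A hAs hA
  obtain ⟨Γ', hle, hidx, hBeq⟩ := ha n (Nat.find hex) B hBs hB hmin
  obtain ⟨m', hm', A', hA's, hA'⟩ := hb n (Nat.find hex) B Γ' hle hBs hBeq
  exact ⟨m', hm'.trans (qpBudget m (Nat.find hex) _ a b hm₀m hidx), A', hA's, hA'⟩

/-- **Lower end of the sandwich**: the symmetry-free a.e. bound `(n!)² ≤ 2^{(log₂ sdc + e)^e}` for
symmetric pencils of `per_n` implies the crux `SymmetrizePermPairs`. [folklore] -/
theorem symmetrizePermPairs_of_factorialSq_le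
    (hH : ∃ e : ℕ, ∀ (n m : ℕ) (A : Matrix (Fin m) (Fin m) (MvPolynomial (Fin n × Fin n) ℂ)),
      A.IsSymm → IsAffineDetRepr (perPoly (Fin n) ℂ) A →
      (Nat.factorial n) ^ 2 ≤ 2 ^ ((Nat.log 2 m + e) ^ e)) :
    SymPencil.SymmetrizePermPairs :=
  symmetrizePermPairs_of_stabIndex (stabIndex_of_factorialSq_le hH)

/-! ### Upper end: the crux alone gives the deciding crux `SdcThesis` -/

/-- **Upper end of the sandwich**: with `EquivariantSdcNotQP` PROVED (item 17792,
`Closer.EquivariantSdcNotQP_proof`) and the split glue `sdcThesis_derived` PROVED, the crux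
`SymmetrizePermPairs` alone implies the route's deciding crux `SdcThesis` ("VNP ⊄ VQP in the
symmetric affine model", ≥ the summit).  `SdcThesis` and `VP ≠ VNP` remain OPEN. [folklore] -/
theorem sdcThesis_of_symmetrizePermPairs (h : SymPencil.SymmetrizePermPairs) : SymPencil.SdcThesis :=
  sdcThesis_derived h SymPencilEquivariantSdcNotQP.Closer.EquivariantSdcNotQP_proof

/-- **The whole sandwich, composed**: the symmetry-free a.e. bound `(n!)² ≤ qp(sdc(per_n))` implies
`SdcThesis` (through the crux).  Both ends are OPEN; this is calibration, not progress. [folklore] -/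
theorem sdcThesis_of_factorialSq_le
    (hH : ∃ e : ℕ, ∀ (n m : ℕ) (A : Matrix (Fin m) (Fin m) (MvPolynomial (Fin n × Fin n) ℂ)),
      A.IsSymm → IsAffineDetRepr (perPoly (Fin n) ℂ) A →
      (Nat.factorial n) ^ 2 ≤ 2 ^ ((Nat.log 2 m + e) ^ e)) :
    SymPencil.SdcThesis :=
  sdcThesis_of_symmetrizePermPairs (symmetrizePermPairs_of_factorialSq_le hH)

end Summit.ValiantsHypothesis.ValiantsHypothesis.Theorems.SymPencilSymmetrizePermPairs.Sandwich

end
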